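import Summits.BirchSwinnertonDyer.BirchSwinnertonDyer.Theorems.ResidualThetaTransportAtTwoResidualSignedLambdaLowerCMAtTwoCofreeSelmerTransferRelaxedAtTwo
import Summits.BirchSwinnertonDyer.BirchSwinnertonDyer.Theorems.ResidualThetaTransportAtTwoResidualSignedLambdaLowerCMAtTwoCofreeSelmerTransfer
import Summits.BirchSwinnertonDyer.BirchSwinnertonDyer.Theorems.ResidualThetaTransportAtTwoResidualSignedLambdaLowerCMAtTwoRhoLayerPairingCompat
import Summits.BirchSwinnertonDyer.BirchSwinnertonDyer.Theorems.ResidualThetaTransportAtTwoResidualSignedLambdaLowerCMAtTwoAwayExhaustion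
import Summits.BirchSwinnertonDyer.BirchSwinnertonDyer.Theorems.ResidualThetaTransportAtTwoThetaTransportResidualArchimedean
import Summits.BirchSwinnertonDyer.BirchSwinnertonDyer.Theorems.ResidualThetaTransportAtTwoResidualSignedLambdaLowerCMAtTwoCofreeSelmerTransferKummer
import Summits.BirchSwinnertonDyer.BirchSwinnertonDyer.Theorems.ThetaPartnerAtTwoSignedTransportAtTwoResidualKummer
import Literature.NumberTheory.EllipticCurves.ZpExtensionSubgroupH1LayerExhaustionProofs
import Literature.NumberTheory.EllipticCurves.OrdinaryNewformDatumCofreeUnramified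
import Literature.NumberTheory.EllipticCurves.H1TrivialAction
import Literature.NumberTheory.EllipticCurves.CyclotomicLayerThetaKummer
import HarnessLib

/-!
# Sketch (stub-ideation `sidea-stub_cmLambdaLower-3-g18`, k = 3, technique «decomposition») — F6 DISSOLVED

Crux `ResidualThetaCountLowerPureAtTwo` (stmt-BirchSwinnertonDyer-26074), stub `stub_cmLambdaLower` = RSL_g
`ResidualSignedLambdaLowerCMAtTwo` (stmt-BirchSwinnertonDyer-22608), skeleton of record `Lines/onepair.lean` (v3a/v3b), open lane EH
(`stub_reciprocity`), critic item F6 = «K1 `KerToCofreeIsThetaKummerTorsion` + `DescKumAt` at `v ∣ 2`» (k3-g16 PLAN C/D, typed only).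

What this file PROVES (kernel-checked, no `sorry`, everything over existing declarations):

* §1 `oneCocycleClass_eq_thetaLayerKummer_of_forall_pointsMap_eq` — **K1♮ (layer Kummer identity ⇒ Θ-Kummer class)**: a cocycle
  `γ : U_m → A_ρ[p^k]` whose Θ-coordinates, pushed into `E(K̄_v)`, satisfy `ι(Θ(γ τ)_i) = τ R_i − R_i` (VERBATIM the currency of
  `AtTwoPins.hc₂` / `exists_towerKummer_of_cocycle`) has `p^k R_i ∈ E(ℚ_{m,v})` and `[γ] = thetaLayerKummer … m (p^k R)`.
  `kerToCofreeIsThetaKummerTorsion` — **K1 of k3-g16 VERBATIM, PROVED** (the `A_ρ`-coboundary case `R_i = ι(Θ(a)_i)`, torsion tuple).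
* §2 `exists_layer_forall_eq_of_forall_kerGroup` — **LX (layer exhaustion of an identity)**: a continuous map on `U_n` into a DISCRETE space
  that is constant on `U_∞ = ⋂ U_m` is constant on some `U_m`, `m ≥ n` (compactness; replaces the class-level level shift K2 of k3-g16,
  the coefficient change F1 and the re-gluing F2: no `H¹(U_m, A_ρ)` is ever formed).
* §1′ `globalDescent_holds` — D1 (k3-g16 §1 `exists_transferH1_eq`), adapted verbatim with credit (Cruxes modules are not importable).
* §3 `descKumAt` — **F6, PROVED OUTRIGHT**: on the habitat (`GoodSS W 2`, `κ` cyclotomic, `v ∋ 2`), `DescKumAt n₀ s` for EVERY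
  `s ∈ H¹(Γ_∞, A_ρ)` and every depth `n₀` — D1 + the landed tower datum `CofreeSelmerTransfer.exists_towerKummer_of_cocycle` (p695679)
  + LX + K1♮ + `resOfLe_pushH1`/`resOfLe_comp_holds`/`layerLocOf_oneCocycleClass`.  No Selmer condition on `s` is needed.

BSD is NOT proved by any of this; RSL_g (22608) and the crux (26074) stay OPEN; EH (`stub_reciprocity`) is not closed here — this file supplies
its `2`-adic descent input (F6) only.

References: [Kobayashi2003] §2 (p. 4), (8.23) (p. 18), Def. 1.1; [GreenbergLNM1716] §2 pp. 83–84, §3 Lemma 3.2; [CoatesGreenberg1996] Cor. 3.2;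
[SerreGaloisCohomology1997] I §2.2 Prop. 8, I §2.4; [NeukirchSchmidtWingberg2008] (1.5.1); [SilvermanAEC2009] VIII §2; [Washington1997] §13.1.
-/

set_option autoImplicit false
set_option linter.dupNamespace false

noncomputable section

open scoped Classical NumberField

namespace Summit.BirchSwinnertonDyer.BirchSwinnertonDyer.Cruxes.ResidualThetaCountLowerPureAtTwo.SideaK3G18

open Field IsDedekindDomain NumberField
  Literature.NumberTheory.EllipticCurves Literature.NumberTheory.GaloisRepresentations
  Literature.NumberTheory.EllipticCurves.GreenbergSelmer Literature.NumberTheory.EllipticCurves.GreenbergVatsal2000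
  Literature.NumberTheory.EllipticCurves.Kobayashi2003 Literature.NumberTheory.EllipticCurves.CyclotomicLayer
  Literature.NumberTheory.GaloisCohomology ZpExtension
  Summit.BirchSwinnertonDyer.BirchSwinnertonDyer.Theorems
  Summit.BirchSwinnertonDyer.BirchSwinnertonDyer.Theorems.ThetaTransport
  Summit.BirchSwinnertonDyer.BirchSwinnertonDyer.Theorems.ThetaTransport.ProfiniteExhaustion
  Summit.BirchSwinnertonDyer.BirchSwinnertonDyer.Theorems.ThetaTransport.CofreeSelmerTransfer

attribute [local instance] absoluteGaloisGroup_compactSpace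

/-! ## §1 K1♮ / K1 — a layer Kummer identity IS a Θ-Kummer class (PROVED) -/

section LayerIdentity

variable {p : ℕ} [Fact p.Prime] (S : Set (PadicAlgCl p)) {d : ℕ} (ρ : FramedGaloisRep ℚ ↥(padicCoeffIntegers S) d)
  (κ : ZpExtension ℚ p) (W : WeierstrassCurve ℚ) [W.IsElliptic] {r : ℕ}
  (Θ : Cofree ρ ↥(padicCoeffField S) ≃+ (Fin r → ↥(W.geomPrimaryTorsion p))) (v : HeightOneSpectrum (𝓞 ℚ))
  (hΘ : ∀ (δ : absoluteGaloisGroup (v.adicCompletion ℚ)) (m : Cofree ρ ↥(padicCoeffField S)) (i : Fin r),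
    Θ (resGalOfEmb (closureEmb (K := ℚ) (v.adicCompletion ℚ)) δ • m) i =
      resGalOfEmb (closureEmb (K := ℚ) (v.adicCompletion ℚ)) δ • Θ m i)

/-- **K1♮ (layer Kummer identity ⇒ Θ-Kummer class).**  If the Θ-coordinates of a cocycle `γ : U_m → A_ρ[p^k]`, pushed into `E(K̄_v)`,
are `τ R_i − R_i` for a tuple `R ∈ E(K̄_v)^r`, then `p^k R_i ∈ E(ℚ_{m,v})` and `[γ] = thetaLayerKummer … m (p^k R)`: `γ = Σ_i Θ⁻¹(κ(R_i)·δ_i)`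
as COCYCLES (`ι` injective, `sum_thetaSingle`), and `thetaLayerKummer (p^k R) = Σ_i (thetaSingle i)_* [κ(R_i)]` for ANY root `R_i`
(`subgroupKummerMap_apply_eq`). [cite: Kobayashi2003, §2 (p. 4), (8.23) (p. 18)] [cite: SilvermanAEC2009, VIII §2] -/
theorem oneCocycleClass_eq_thetaLayerKummer_of_forall_pointsMap_eq (k m : ℕ)
    (γ : contOneCocycles (subgroupRep (cofreeTorsionLocalRep S ρ ((p ^ k : ℕ) : ℤ) v) (layerGroup κ v m)))
    (R : Fin r → localPoints W (v.adicCompletion ℚ))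
    (hγ : ∀ (τ : ↥(layerGroup κ v m)) (i : Fin r),
      pointsMap W (v.adicCompletion ℚ)
        ((Θ ((γ.1 τ : ↥(AddSubgroup.torsionBy (Cofree ρ ↥(padicCoeffField S)) ((p ^ k : ℕ) : ℤ))) :
          Cofree ρ ↥(padicCoeffField S)) i : ↥(W.geomPrimaryTorsion p)) : W.geomPoints) =
        (τ : absoluteGaloisGroup (v.adicCompletion ℚ)) • R i - R i) :
    ∃ hR : ∀ i, ((p ^ k : ℕ) : ℤ) • R i ∈ localLayerPointsOfEmb κ (closureEmb (K := ℚ) (v.adicCompletion ℚ)) W m,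
      oneCocycleClass _ γ = thetaLayerKummer S ρ k W Θ κ v hΘ m (fun i ↦ ⟨((p ^ k : ℕ) : ℤ) • R i, hR i⟩) := by
  have hN0 : ((p ^ k : ℕ) : ℤ) ≠ 0 := by exact_mod_cast pow_ne_zero k (Fact.out : p.Prime).ne_zero
  have htor : ∀ τ : ↥(layerGroup κ v m),
      ((p ^ k : ℕ) : ℤ) • ((γ.1 τ : ↥(AddSubgroup.torsionBy (Cofree ρ ↥(padicCoeffField S)) ((p ^ k : ℕ) : ℤ))) :
        Cofree ρ ↥(padicCoeffField S)) = 0 :=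
    fun τ ↦ (Submodule.mem_torsionBy_iff (R := ℤ) _ _).mp
      (γ.1 τ : ↥(AddSubgroup.torsionBy (Cofree ρ ↥(padicCoeffField S)) ((p ^ k : ℕ) : ℤ))).2
  -- (1) `p^k R_i` is `U_m`-fixed: `τ(p^k R_i) − p^k R_i = p^k ι(Θ(γ τ)_i) = ι(Θ(p^k γ τ)_i) = 0`
  have hR : ∀ i, ((p ^ k : ℕ) : ℤ) • R i ∈ localLayerPointsOfEmb κ (closureEmb (K := ℚ) (v.adicCompletion ℚ)) W m := by
    intro i
    rw [mem_localLayerPointsOfEmb_iff]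
    intro τ hτ
    have h0 : pointsMap W (v.adicCompletion ℚ)
        ((Θ ((γ.1 ⟨τ, hτ⟩ : ↥(AddSubgroup.torsionBy (Cofree ρ ↥(padicCoeffField S)) ((p ^ k : ℕ) : ℤ))) :
          Cofree ρ ↥(padicCoeffField S)) i : ↥(W.geomPrimaryTorsion p)) : W.geomPoints) = τ • R i - R i := hγ ⟨τ, hτ⟩ i
    have h2 : ((p ^ k : ℕ) : ℤ) • (τ • R i - R i) = 0 := by
      rw [← h0, ← map_zsmul, ← AddSubgroupClass.coe_zsmul, ← Pi.smul_apply, ← map_zsmul, htor ⟨τ, hτ⟩, map_zero]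
      simp
    rw [← sub_eq_zero, smul_comm τ (((p ^ k : ℕ) : ℤ)) (R i), ← zsmul_sub, h2]
  refine ⟨hR, ?_⟩
  -- (2) the Kummer cocycles of the roots `R_i` and their Θ-transports
  let P : Fin r → contOneCocycles (subgroupRep (torsionLocalRep W (p ^ k) v) (layerGroup κ v m)) :=
    fun i ↦ W.subgroupKummerCocycle ((p ^ k : ℕ) : ℤ) (layerGroup κ v m) hN0 (R i) (hR i)
  let ψ : Fin r → contOneCocycles (subgroupRep (cofreeTorsionLocalRep S ρ ((p ^ k : ℕ) : ℤ) v) (layerGroup κ v m)) :=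
    fun i ↦ contOneCocycles.pushAddHom (thetaSingle ρ p k W Θ i) continuous_of_discreteTopology
      (thetaSingle_subgroupRep S ρ k W Θ κ v hΘ i m) (P i)
  have hKi : ∀ i, thetaSingleH1 S ρ k W Θ κ v hΘ i m
      (layerKummer W (p ^ k) κ v m ⟨((p ^ k : ℕ) : ℤ) • R i, hR i⟩) = oneCocycleClass _ (ψ i) := by
    intro i
    have hK : layerKummer W (p ^ k) κ v m ⟨((p ^ k : ℕ) : ℤ) • R i, hR i⟩ = oneCocycleClass _ (P i) :=
      W.subgroupKummerMap_apply_eq ((p ^ k : ℕ) : ℤ) (layerGroup κ v m) hN0 _ (R i) (hR i) rfl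
    rw [hK, thetaSingleH1_oneCocycleClass]
  -- (3) `γ = Σ_i ψ_i` as cocycles: compare Θ-coordinates in `E(K̄_v)` through the injective `ι`
  have hval : ∀ τ : ↥(layerGroup κ v m),
      ((γ.1 τ : ↥(AddSubgroup.torsionBy (Cofree ρ ↥(padicCoeffField S)) ((p ^ k : ℕ) : ℤ))) : Cofree ρ ↥(padicCoeffField S)) =
        ∑ i, (((ψ i).1 τ : ↥(AddSubgroup.torsionBy (Cofree ρ ↥(padicCoeffField S)) ((p ^ k : ℕ) : ℤ))) :
          Cofree ρ ↥(padicCoeffField S)) := by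
    intro τ
    have e : ∀ i, (((ψ i).1 τ : ↥(AddSubgroup.torsionBy (Cofree ρ ↥(padicCoeffField S)) ((p ^ k : ℕ) : ℤ))) :
        Cofree ρ ↥(padicCoeffField S)) =
        ((thetaSingle ρ p k W Θ i ((P i).1 τ) : ↥(AddSubgroup.torsionBy (Cofree ρ ↥(padicCoeffField S)) ((p ^ k : ℕ) : ℤ))) :
          Cofree ρ ↥(padicCoeffField S)) := fun i ↦ rfl
    simp only [e]
    rw [sum_thetaSingle ρ p k W Θ (fun i ↦ (P i).1 τ)]
    apply Θ.injective
    rw [AddEquiv.apply_symm_apply]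
    funext i
    apply Subtype.ext
    apply pointsMapOfEmb_injective W (closureEmb (K := ℚ) (v.adicCompletion ℚ))
    change pointsMap W (v.adicCompletion ℚ)
        ((Θ ((γ.1 τ : ↥(AddSubgroup.torsionBy (Cofree ρ ↥(padicCoeffField S)) ((p ^ k : ℕ) : ℤ))) :
          Cofree ρ ↥(padicCoeffField S)) i : ↥(W.geomPrimaryTorsion p)) : W.geomPoints) =
      pointsMap W (v.adicCompletion ℚ) (((P i).1 τ : _root_.WeierstrassCurve.geomTorsion W ((p ^ k : ℕ) : ℤ)) : W.geomPoints)
    rw [hγ τ i]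
    exact (W.pointsMap_subgroupKummerCocycle_apply ((p ^ k : ℕ) : ℤ) (layerGroup κ v m) hN0 (R i) (hR i) τ).symm
  have hγsum : γ = ∑ i, ψ i := by
    refine Subtype.ext (ContinuousMap.ext fun τ ↦ ?_)
    rw [AddSubmonoidClass.coe_finsetSum, ContinuousMap.sum_apply]
    exact Subtype.ext ((hval τ).trans (AddSubmonoidClass.coe_finsetSum _ _).symm)
  rw [hγsum, ← oneCocycleClassₗ_apply, map_sum, thetaLayerKummer_apply]
  exact Finset.sum_congr rfl fun i _ ↦ (by rw [oneCocycleClassₗ_apply]; exact (hKi i).symm)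

/-- **K1 (k3-g16 `KerToCofreeIsThetaKummerTorsion`, VERBATIM conclusion, PROVED).**  A cocycle `γ : U_m → A_ρ[p^k]` that is an
`A_ρ`-coboundary `τ ↦ τ a − a` is the Θ-Kummer class of the TORSION tuple `T_i = p^k ι(Θ(a)_i) ∈ E(ℚ_{m,v})` (K1♮ with `R_i = ι(Θ(a)_i)`,
equivariance `hΘ` and `pointsMapOfEmb_smul`). [cite: Kobayashi2003, §2 (p. 4), (8.23) (p. 18)] [cite: Greenberg1989, §1 p. 98] -/
theorem kerToCofreeIsThetaKummerTorsion (k m : ℕ)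
    (γ : contOneCocycles (subgroupRep (cofreeTorsionLocalRep S ρ ((p ^ k : ℕ) : ℤ) v) (layerGroup κ v m)))
    (a : Cofree ρ ↥(padicCoeffField S))
    (ha : ∀ τ : ↥(layerGroup κ v m),
      ((γ.1 τ : ↥(AddSubgroup.torsionBy (Cofree ρ ↥(padicCoeffField S)) ((p ^ k : ℕ) : ℤ))) : Cofree ρ ↥(padicCoeffField S)) =
        resGalOfEmb (closureEmb (K := ℚ) (v.adicCompletion ℚ)) (τ : absoluteGaloisGroup (v.adicCompletion ℚ)) • a - a) :
    ∃ T : Fin r → ↥(localLayerPointsOfEmb κ (closureEmb (K := ℚ) (v.adicCompletion ℚ)) W m),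
      (∀ i, ∃ e : ℕ, p ^ e • (T i : localPoints W (v.adicCompletion ℚ)) = 0) ∧
      oneCocycleClass _ γ = thetaLayerKummer S ρ k W Θ κ v hΘ m T := by
  obtain ⟨hR, hcl⟩ := oneCocycleClass_eq_thetaLayerKummer_of_forall_pointsMap_eq S ρ κ W Θ v hΘ k m γ
    (fun i ↦ pointsMap W (v.adicCompletion ℚ) ((Θ a i : ↥(W.geomPrimaryTorsion p)) : W.geomPoints)) (fun τ i ↦ by
      rw [ha τ, map_sub, Pi.sub_apply, hΘ, AddSubgroupClass.coe_sub, map_sub, primaryComponent.coe_smul]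
      exact congrArg (· - _) (pointsMapOfEmb_smul W (closureEmb (K := ℚ) (v.adicCompletion ℚ)) _ _))
  refine ⟨_, fun i ↦ ?_, hcl⟩
  obtain ⟨e, he⟩ := (Θ a i).2
  refine ⟨e, ?_⟩
  change p ^ e • (((p ^ k : ℕ) : ℤ) • pointsMap W (v.adicCompletion ℚ) ((Θ a i : ↥(W.geomPrimaryTorsion p)) : W.geomPoints)) = 0
  rw [smul_comm, ← map_nsmul, he, map_zero, smul_zero]

/-- **DescKumAt (k3-g16, VERBATIM): the [kum] reading of a descended class** — `s = τ_{n,k} b` for a deep `n ≥ n₀`, an exponent `k`, a level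
class `b ∈ H¹(Γ_n, A_ρ[p^k])` and a tuple `Q₁ ∈ E(ℚ_{n,v})^r` with `loc_n b = thetaLayerKummer Q₁` (the `hkum` input of T3♮ and of the
S4₂ assembly). [cite: Kobayashi2003, (8.23)] [cite: GreenbergLNM1716, §3 Lemma 3.2] -/
def DescKumAt (n₀ : ℕ) (s : subgroupH1 κ.kerSubgroup (Cofree ρ ↥(padicCoeffField S))) : Prop :=
  ∃ n : ℕ, n₀ ≤ n ∧ ∃ (k : ℕ) (b : H1 (cofreeTorsionGaloisModule S ρ ((p ^ k : ℕ) : ℤ)) (κ.layerSubgroup n))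
    (Q₁ : Fin r → ↥(localLayerPointsOfEmb κ (closureEmb (K := ℚ) (v.adicCompletion ℚ)) W n)),
    resOfLe (Cofree ρ ↥(padicCoeffField S)) (κ.kerSubgroup_le_layerSubgroup n)
        (pushH1 (κ.layerSubgroup n) (AddSubgroup.torsionBy (Cofree ρ ↥(padicCoeffField S)) ((p ^ k : ℕ) : ℤ)).subtype
          (torsionBy_subtype_smul S ρ ((p ^ k : ℕ) : ℤ)) b) = s ∧
      layerLocOf (cofreeTorsionGaloisModule S ρ ((p ^ k : ℕ) : ℤ)) κ v n b = thetaLayerKummer S ρ k W Θ κ v hΘ n Q₁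

/-- **D1 (global descent of the test class) as a SIGNATURE** — verbatim the conclusion of k3-g16 §1 `exists_transferH1_eq` (sketch-proved
there from `exists_pow_smul_subgroupH1_eq_zero` + Kummer surjectivity + `exists_mem_range_resOfLe_of_le`); the one remaining sub-stub of F6.
[cite: GreenbergLNM1716, §3 Lemma 3.2] [cite: SerreGaloisCohomology1997, I §2.2 Prop. 8] -/
def GlobalDescent : Prop :=
  ∀ (n₀ k₀ : ℕ) (s : subgroupH1 κ.kerSubgroup (Cofree ρ ↥(padicCoeffField S))),
    ∃ n : ℕ, n₀ ≤ n ∧ ∃ k : ℕ, k₀ ≤ k ∧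
      ∃ b : subgroupH1 (κ.layerSubgroup n) ↥(AddSubgroup.torsionBy (Cofree ρ ↥(padicCoeffField S)) ((p ^ k : ℕ) : ℤ)),
        resOfLe (Cofree ρ ↥(padicCoeffField S)) (κ.kerSubgroup_le_layerSubgroup n)
          (pushH1 (κ.layerSubgroup n) (AddSubgroup.torsionBy (Cofree ρ ↥(padicCoeffField S)) ((p ^ k : ℕ) : ℤ)).subtype
            (torsionBy_subtype_smul S ρ ((p ^ k : ℕ) : ℤ)) b) = s

/-! ### §1′ D1 holds — ADAPTED VERBATIM from k3-g16 §1 (`SideaK3G16.exists_transferH1_eq`, sketch-proved there; `Cruxes/` modules are not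
importable, so the three lemmas are repeated here for a kernel-complete F6; credit: sidea-stub_cmLambdaLower-3-g16). -/

/-- (k3-g16) The points of `A_ρ[N]` have open stabilisers. [cite: Greenberg1989, §1 p. 98] -/
theorem isOpen_stabilizer_cofreeTorsion (N : ℤ) (m : ↥(AddSubgroup.torsionBy (Cofree ρ ↥(padicCoeffField S)) N)) :
    IsOpen (MulAction.stabilizer (absoluteGaloisGroup ℚ) m : Set (absoluteGaloisGroup ℚ)) := by
  have e : (MulAction.stabilizer (absoluteGaloisGroup ℚ) m : Set (absoluteGaloisGroup ℚ)) =
      MulAction.stabilizer (absoluteGaloisGroup ℚ) (m : Cofree ρ ↥(padicCoeffField S)) := by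
    ext g
    simp only [SetLike.mem_coe, MulAction.mem_stabilizer_iff, Subtype.ext_iff]
    exact Iff.rfl
  rw [e]
  exact isOpen_stabilizer_cofree S ρ _

/-- (k3-g16) `A_ρ[N]` is `p`-primary. [cite: GreenbergLNM1716, §1] -/
theorem exists_pow_smul_cofreeTorsion_eq_zero (N : ℤ) (m : ↥(AddSubgroup.torsionBy (Cofree ρ ↥(padicCoeffField S)) N)) :
    ∃ k : ℕ, p ^ k • m = 0 := by
  obtain ⟨k, hk⟩ := GreenbergSelmer.exists_pow_smul_cofree_eq_zero S ρ (m : Cofree ρ ↥(padicCoeffField S))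
  exact ⟨k, Subtype.ext (by rw [AddSubmonoidClass.coe_nsmul, ZeroMemClass.coe_zero]; exact hk)⟩

/-- (k3-g16) **coefficient descent at `∞`**: a class of `H¹(Γ_∞, A_ρ)` killed by `p^k` is `ι_* s'`, `s' ∈ H¹(Γ_∞, A_ρ[p^k])`
(Kummer surjectivity for the divisible `A_ρ`). [cite: SerreGaloisCohomology1997, I §2.2] [cite: GreenbergLNM1716, §2 p. 71] -/
theorem exists_pushH1_torsionBy_eq_of_pow_smul_eq_zero (k : ℕ) (s : subgroupH1 κ.kerSubgroup (Cofree ρ ↥(padicCoeffField S)))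
    (hk : p ^ k • s = 0) :
    ∃ s' : subgroupH1 κ.kerSubgroup ↥(AddSubgroup.torsionBy (Cofree ρ ↥(padicCoeffField S)) ((p ^ k : ℕ) : ℤ)),
      pushH1 κ.kerSubgroup (AddSubgroup.torsionBy (Cofree ρ ↥(padicCoeffField S)) ((p ^ k : ℕ) : ℤ)).subtype
        (torsionBy_subtype_smul S ρ ((p ^ k : ℕ) : ℤ)) s' = s := by
  have hp : (p ^ k : ℕ) ≠ 0 := pow_ne_zero k (Fact.out : p.Prime).ne_zero
  obtain ⟨s', hs'⟩ := SignedTransportAtTwo.mem_range_pushH1_of_nsmul_eq_zero (G := ↥κ.kerSubgroup)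
    (AddSubgroup.torsionBy (Cofree ρ ↥(padicCoeffField S)) ((p ^ k : ℕ) : ℤ)).subtype
    (fun g x ↦ torsionBy_subtype_smul S ρ ((p ^ k : ℕ) : ℤ) g x) Subtype.val_injective
    (fun m hm ↦ ⟨⟨m, (Submodule.mem_torsionBy_iff _ m).mpr (by rw [natCast_zsmul]; exact hm)⟩, rfl⟩)
    (Cofree.divisible ↥(padicCoeffField S) ρ hp)
    (fun m ↦ (continuous_smul_of_isOpen_stabilizer' (Cofree ρ ↥(padicCoeffField S)) (isOpen_stabilizer_cofree S ρ) m).comp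
      continuous_subtype_val)
    hk
  exact ⟨s', hs'⟩

/-- **D1 holds** (k3-g16 `exists_transferH1_eq`, adapted verbatim): every `s ∈ H¹(Γ_∞, A_ρ)` is `τ_{n,k} b`, `n ≥ n₀`, `k ≥ k₀`.
[cite: GreenbergLNM1716, §3 Lemma 3.2] [cite: SerreGaloisCohomology1997, I §2.2 Prop. 8] [cite: NeukirchSchmidtWingberg2008, (1.5.1)] -/
theorem globalDescent_holds : GlobalDescent S ρ κ := by
  intro n₀ k₀ s
  obtain ⟨k₁, hk₁⟩ := exists_pow_smul_subgroupH1_eq_zero κ (Cofree ρ ↥(padicCoeffField S)) (GreenbergSelmer.exists_pow_smul_cofree_eq_zero S ρ) s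
  have hk : p ^ (k₁ + k₀) • s = 0 := by rw [pow_add, mul_comm, mul_smul, hk₁, smul_zero]
  obtain ⟨s', rfl⟩ := exists_pushH1_torsionBy_eq_of_pow_smul_eq_zero S ρ κ (k₁ + k₀) s hk
  obtain ⟨n, hn, b, hb⟩ := exists_mem_range_resOfLe_of_le κ
    ↥(AddSubgroup.torsionBy (Cofree ρ ↥(padicCoeffField S)) ((p ^ (k₁ + k₀) : ℕ) : ℤ))
    (isOpen_stabilizer_cofreeTorsion S ρ _) (exists_pow_smul_cofreeTorsion_eq_zero S ρ _) n₀ s'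
  refine ⟨n, hn, k₁ + k₀, Nat.le_add_left k₀ k₁, b, ?_⟩
  rw [ThetaTransport.resOfLe_pushH1 _ (torsionBy_subtype_smul S ρ ((p ^ (k₁ + k₀) : ℕ) : ℤ)) (κ.kerSubgroup_le_layerSubgroup n) b, hb]

end LayerIdentity

/-! ## §2 LX — layer exhaustion of an identity (PROVED) -/

section LayerExhaustion

variable {p : ℕ} [Fact p.Prime] (κ : ZpExtension ℚ p) (v : HeightOneSpectrum (𝓞 ℚ))

/-- **LX (layer exhaustion of an identity).**  A continuous map on `U_n` with values in a DISCRETE space which is constant (`= y₀`) on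
`U_∞ = ⋂_m U_m` is already constant on some `U_m`, `m ≥ n`: the bad set `{f ≠ y₀}` is compact and misses the intersection of the closed
decreasing `U_m` (`kerGroup_eq_iInf_layerGroup`), hence misses one of them.  This is the cocycle-level substitute for
`H¹(U_∞, A) = lim→ H¹(U_m, A)`. [cite: SerreGaloisCohomology1997, I §2.2 Prop. 8] [cite: Washington1997, §13.1] -/
theorem exists_layer_forall_eq_of_forall_kerGroup (n : ℕ) {Y : Type*} [TopologicalSpace Y] [DiscreteTopology Y]
    (f : ↥(layerGroup κ v n) → Y) (hf : Continuous f) (y₀ : Y)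
    (h : ∀ τ : ↥(layerGroup κ v n), (τ : absoluteGaloisGroup (v.adicCompletion ℚ)) ∈ kerGroup κ v → f τ = y₀) :
    ∃ m : ℕ, n ≤ m ∧ ∀ τ : ↥(layerGroup κ v n), (τ : absoluteGaloisGroup (v.adicCompletion ℚ)) ∈ layerGroup κ v m → f τ = y₀ := by
  haveI : CompactSpace ↥(layerGroup κ v n) := isCompact_iff_compactSpace.mp (isClosed_layerGroup κ v n).isCompact
  have hC : IsCompact (Subtype.val '' (f ⁻¹' ({y₀}ᶜ : Set Y))) :=
    ((isClosed_discrete ({y₀}ᶜ : Set Y)).preimage hf).isCompact.image continuous_subtype_val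
  have hst : Subtype.val '' (f ⁻¹' ({y₀}ᶜ : Set Y)) ∩
      ⋂ m : ℕ, ((layerGroup κ v m : Subgroup _) : Set (absoluteGaloisGroup (v.adicCompletion ℚ))) = ∅ := by
    rw [← Subgroup.coe_iInf, ← kerGroup_eq_iInf_layerGroup, Set.eq_empty_iff_forall_notMem]
    rintro σ ⟨⟨τ, hτC, rfl⟩, hσ⟩
    exact (Set.mem_compl_singleton_iff.mp hτC) (h τ hσ)
  have hdt : Directed (· ⊇ ·)
      (fun m : ℕ ↦ ((layerGroup κ v m : Subgroup _) : Set (absoluteGaloisGroup (v.adicCompletion ℚ)))) :=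
    directed_of_isDirected_le fun i j hij ↦ SetLike.coe_subset_coe.mpr (antitone_layerGroup κ v hij)
  obtain ⟨m, hm⟩ := hC.elim_directed_family_closed _ (fun m ↦ isClosed_layerGroup κ v m) hst hdt
  refine ⟨max n m, le_max_left n m, fun τ hτ ↦ ?_⟩
  by_contra hne
  have hmem : (τ : absoluteGaloisGroup (v.adicCompletion ℚ)) ∈ Subtype.val '' (f ⁻¹' ({y₀}ᶜ : Set Y)) ∩
      ((layerGroup κ v m : Subgroup _) : Set (absoluteGaloisGroup (v.adicCompletion ℚ))) :=
    ⟨⟨τ, Set.mem_compl_singleton_iff.mpr hne, rfl⟩, antitone_layerGroup κ v (le_max_right n m) hτ⟩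
  rw [hm] at hmem
  exact hmem

end LayerExhaustion

/-! ## §3 F6 — `DescKumAt` at `v ∋ 2` from D1 alone (GLUE PROVED) -/

section DescKum

variable (S : Set (PadicAlgCl 2)) {d : ℕ} (ρ : FramedGaloisRep ℚ ↥(padicCoeffIntegers S) d)
  (κ : ZpExtension ℚ 2) (W : WeierstrassCurve ℚ) [W.IsElliptic] [W.IsGloballyMinimal] {r : ℕ}
  (Θ : Cofree ρ ↥(padicCoeffField S) ≃+ (Fin r → ↥(W.geomPrimaryTorsion 2))) (v : HeightOneSpectrum (𝓞 ℚ))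
  (hΘ : ∀ (δ : absoluteGaloisGroup (v.adicCompletion ℚ)) (m : Cofree ρ ↥(padicCoeffField S)) (i : Fin r),
    Θ (resGalOfEmb (closureEmb (K := ℚ) (v.adicCompletion ℚ)) δ • m) i =
      resGalOfEmb (closureEmb (K := ℚ) (v.adicCompletion ℚ)) δ • Θ m i)

set_option maxHeartbeats 1600000 in
-- the two cohomology dialects on `A_ρ[2^k]` (`discreteTopRep_cofreeTorsionBy_eq`, `rfl`) unify slowly
/-- **F6 (the `2`-adic descent reading; PROVED).**  On the habitat (`W` good supersingular at `2`, `κ` cyclotomic, `v ∋ 2`), global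
descent D1 (`globalDescent_holds`) gives `DescKumAt n₀ s` for EVERY class `s ∈ H¹(Γ_∞, A_ρ)` and every depth `n₀`: take `s = τ_{n,k} b` (D1), read the
global cocycle `φ` of `b` on `U_{∞,v}` through `Θ` — it is the Kummer cocycle of a tuple `Q` (`exists_towerKummer_of_cocycle`, landed,
Coates–Greenberg); the identity `ι(Θ(φ τ)_i) = τQ_i − Q_i` is between continuous maps `U_n → E(K̄_v)` (discrete) agreeing on `U_∞ = ⋂ U_m`,
so it holds on some `U_m` (LX); there K1♮ says `loc_m(res b) = thetaLayerKummer (2^k Q)`, and `τ_{m,k}(res b) = τ_{n,k} b = s`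
(`resOfLe_pushH1`, `resOfLe_comp_holds`). [cite: GreenbergLNM1716, §2 pp. 83–84, §3 Lemma 3.2] [cite: CoatesGreenberg1996, Cor. 3.2]
[cite: Kobayashi2003, (8.23)] [cite: SerreGaloisCohomology1997, I §2.2 Prop. 8] -/
theorem descKumAt (hGood : Rank1Residual.GoodSS W 2) (hκ : κ.IsCyclotomic)
    (hv : ((2 : ℕ) : 𝓞 ℚ) ∈ v.asIdeal)
    (n₀ : ℕ) (s : subgroupH1 κ.kerSubgroup (Cofree ρ ↥(padicCoeffField S))) : DescKumAt S ρ κ W Θ v hΘ n₀ s := by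
  obtain ⟨n, hn, k, -, b, hb⟩ := globalDescent_holds S ρ κ n₀ 0 s
  -- abbreviations
  let A : Type := ↥(AddSubgroup.torsionBy (Cofree ρ ↥(padicCoeffField S)) ((2 ^ k : ℕ) : ℤ))
  let ι := closureEmb (K := ℚ) (v.adicCompletion ℚ)
  obtain ⟨φ, rfl⟩ := oneCocycleClass_surjective (discreteTopRep ↥(κ.layerSubgroup n) A) b
  -- the cocycle of `res_{Γ_∞} b`
  let φinf : contOneCocycles (discreteTopRep ↥κ.kerSubgroup A) :=
    contOneCocycles.pullback (subgroupInclusion (κ.kerSubgroup_le_layerSubgroup n))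
      (resHomOfEquivariant (subgroupInclusion (κ.kerSubgroup_le_layerSubgroup n)) (AddMonoidHom.id A) fun _ _ ↦ rfl) φ
  -- `Θ` on `A_ρ[2^k]`
  let Ψ : A →+ (Fin r → ↥(W.geomPrimaryTorsion 2)) :=
    Θ.toAddMonoidHom.comp (AddSubgroup.torsionBy (Cofree ρ ↥(padicCoeffField S)) ((2 ^ k : ℕ) : ℤ)).subtype
  have hΨ : ∀ (δ : absoluteGaloisGroup (v.adicCompletion ℚ)) (m : A) (i : Fin r),
      Ψ (resGalOfEmb ι δ • m) i = resGalOfEmb ι δ • Ψ m i := fun δ m i ↦ hΘ δ (m : Cofree ρ ↥(padicCoeffField S)) i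
  -- the tower datum (landed, Coates–Greenberg): `ι(Θ(φ τ)_i) = τ Q_i − Q_i` on `U_∞`
  obtain ⟨Q, -, -, hQ⟩ := exists_towerKummer_of_cocycle W hGood κ hκ v hv Ψ hΨ φinf
  -- the discrepancy on `U_n`, a continuous map into the discrete `E(K̄_v)^r`
  let g : ↥(layerGroup κ v n) → (Fin r → localPoints W (v.adicCompletion ℚ)) := fun τ i ↦
    pointsMapOfEmb W ι ((Ψ (φ.1 (resGalSubgroupOfEmb (κ.layerSubgroup n) ι τ)) i : ↥(W.geomPrimaryTorsion 2)) : W.geomPoints) -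
      ((τ : absoluteGaloisGroup (v.adicCompletion ℚ)) • Q i - Q i)
  have hg : Continuous g := by
    refine continuous_pi fun i ↦ Continuous.sub ?_ ?_
    · exact (continuous_of_discreteTopology (f := fun a : A ↦
          pointsMapOfEmb W ι ((Ψ a i : ↥(W.geomPrimaryTorsion 2)) : W.geomPoints))).comp
        (φ.1.continuous.comp (map_continuous (resGalSubgroupOfEmb (κ.layerSubgroup n) ι)))
    · exact (((continuous_smul_of_isOpen_stabilizer (Q i) (W.isOpen_stabilizer_localPoints _ (Q i))).comp
        continuous_subtype_val).sub continuous_const)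
  have hg0 : ∀ τ : ↥(layerGroup κ v n), (τ : absoluteGaloisGroup (v.adicCompletion ℚ)) ∈ kerGroup κ v → g τ = 0 := by
    intro τ hτ
    funext i
    change pointsMapOfEmb W ι ((Ψ (φ.1 (resGalSubgroupOfEmb (κ.layerSubgroup n) ι τ)) i : ↥(W.geomPrimaryTorsion 2)) :
        W.geomPoints) - ((τ : absoluteGaloisGroup (v.adicCompletion ℚ)) • Q i - Q i) = 0
    -- `φ (U_n-image of τ) = φ∞ (U_∞-image of τ)`: the same element `⟨τ|_ℚ̄, _⟩` of `Γ_n`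
    exact sub_eq_zero.mpr (hQ ⟨τ, hτ⟩ i)
  -- LX: the identity holds on some layer `U_m`, `m ≥ n`
  obtain ⟨m, hnm, hm⟩ := exists_layer_forall_eq_of_forall_kerGroup κ v n g hg 0 hg0
  have hle : κ.layerSubgroup m ≤ κ.layerSubgroup n := κ.layerSubgroup_antitone hnm
  -- descend `b` to level `m`
  let φm : contOneCocycles (discreteTopRep ↥(κ.layerSubgroup m) A) :=
    contOneCocycles.pullback (subgroupInclusion hle)
      (resHomOfEquivariant (subgroupInclusion hle) (AddMonoidHom.id A) fun _ _ ↦ rfl) φ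
  have hbm : resOfLe A hle (oneCocycleClass _ φ) = oneCocycleClass _ φm := by
    rw [Literature.NumberTheory.EllipticCurves.resOfLe, resH1Hom_oneCocycleClass]
  -- the local cocycle at level `m` and its Kummer identity
  let γ : contOneCocycles (subgroupRep (cofreeTorsionLocalRep S ρ ((2 ^ k : ℕ) : ℤ) v) (layerGroup κ v m)) :=
    contOneCocycles.pullback (resGalSubgroupOfEmb (κ.layerSubgroup m) ι)
      (X := subgroupRep (cofreeTorsionGaloisModule S ρ ((2 ^ k : ℕ) : ℤ)).toTopRep (κ.layerSubgroup m))
      (Y := subgroupRep (localRepOf (cofreeTorsionGaloisModule S ρ ((2 ^ k : ℕ) : ℤ)) v) (layerGroup κ v m))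
      (TopRep.ofHom ⟨ContinuousLinearMap.id ℤ A, fun _ ↦ rfl⟩) φm
  have hloc : layerLocOf (cofreeTorsionGaloisModule S ρ ((2 ^ k : ℕ) : ℤ)) κ v m (oneCocycleClass _ φm) = oneCocycleClass _ γ :=
    layerLocOf_oneCocycleClass v (cofreeTorsionGaloisModule S ρ ((2 ^ k : ℕ) : ℤ)) κ m φm
  have hγ : ∀ (τ : ↥(layerGroup κ v m)) (i : Fin r),
      pointsMap W (v.adicCompletion ℚ)
        ((Θ ((γ.1 τ : A) : Cofree ρ ↥(padicCoeffField S)) i : ↥(W.geomPrimaryTorsion 2)) : W.geomPoints) =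
        (τ : absoluteGaloisGroup (v.adicCompletion ℚ)) • Q i - Q i := by
    intro τ i
    have hτn : (τ : absoluteGaloisGroup (v.adicCompletion ℚ)) ∈ layerGroup κ v n := antitone_layerGroup κ v hnm τ.2
    have h1 := congrFun (hm ⟨τ, hτn⟩ τ.2) i
    change pointsMapOfEmb W ι ((Ψ (φ.1 (resGalSubgroupOfEmb (κ.layerSubgroup n) ι ⟨τ, hτn⟩)) i : ↥(W.geomPrimaryTorsion 2)) :
        W.geomPoints) - ((τ : absoluteGaloisGroup (v.adicCompletion ℚ)) • Q i - Q i) = 0 at h1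
    -- `γ τ = φ (Γ_m ↪ Γ_n) (U_m-image of τ) = φ (U_n-image of τ)`: the same element `⟨τ|_ℚ̄, _⟩` of `Γ_n`
    exact sub_eq_zero.mp h1
  obtain ⟨hR, hcl⟩ := oneCocycleClass_eq_thetaLayerKummer_of_forall_pointsMap_eq S ρ κ W Θ v hΘ k m γ Q hγ
  -- assemble `DescKumAt`
  -- `τ_{m,k}(res b) = τ_{n,k} b = s`
  have hτ : resOfLe (Cofree ρ ↥(padicCoeffField S)) (κ.kerSubgroup_le_layerSubgroup m)
      (pushH1 (κ.layerSubgroup m) (AddSubgroup.torsionBy (Cofree ρ ↥(padicCoeffField S)) ((2 ^ k : ℕ) : ℤ)).subtype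
        (torsionBy_subtype_smul S ρ ((2 ^ k : ℕ) : ℤ)) (oneCocycleClass (discreteTopRep ↥(κ.layerSubgroup m) A) φm)) = s := by
    rw [resOfLe_pushH1] at hb
    rw [← hbm, resOfLe_pushH1, ← AddMonoidHom.comp_apply (resOfLe A (κ.kerSubgroup_le_layerSubgroup m)) (resOfLe A hle),
      resOfLe_comp_holds (M := A) (κ.kerSubgroup_le_layerSubgroup m) hle]
    exact hb
  exact ⟨m, hn.trans hnm, k, oneCocycleClass (discreteTopRep ↥(κ.layerSubgroup m) A) φm,
    fun i ↦ ⟨((2 ^ k : ℕ) : ℤ) • Q i, hR i⟩, hτ, hloc.trans hcl⟩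

end DescKum

end Summit.BirchSwinnertonDyer.BirchSwinnertonDyer.Cruxes.ResidualThetaCountLowerPureAtTwo.SideaK3G18

end
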